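import Summits.CriticalPhenomena.PercolationContinuityZ3.Theorems.PercNearOneGluingNoHeavyLowerTailQuantitativeS5HarrisFloor
import Summits.CriticalPhenomena.PercolationContinuityZ3.Theorems.PercNearOneGluingNoHeavyLowerTailQuantitativeHarrisInfluenceFloor
import Summits.CriticalPhenomena.PercolationContinuityZ3.Theorems.PercNearOneGluingNoHeavyLowerTailQuantitativeBHKStrict
import HarnessLib

/-!
# The (S5) Harris floor made graph-explicit and size-free: the world floor dominated by the «earlier relays isolated» world

Support file (`--supports stmt-CriticalPhenomena-4575`), prover seat `prim-rate-mine-2` (lane prim-rate, constants-miner (c), BENCH row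
M2-R21; `run/shared/lean/prim/prim-rate/prim-rate-mine-2/CANDIDATES.md` §gen-4).  No definitions, no named facts, no sorries; standard axioms.

Row M2-R6 (`CSH.s5dMargin_ge_sum_rankGain_add_worldFloor`, kernel): the (S5) surplus-transfer margin at every `|T|` dominates the rank gains plus
the WORLD floors `CSH.worldFloor w a Y S o v F` — averages over the worlds `ω ∈ {a ↮ Y}` of residual Harris covariances, `Y` = the relays peeled
before `a`.  THIS FILE bounds every world floor from below by ONE fixed-graph Harris covariance:

  `∏_{e ∩ Y ≠ ∅} (1 − w_e) · Cov_{w_Y}(F(Ĉ_a), 1_U) ≤ worldFloor w a Y S o v F`   (`CSH.isolated_harris_le_worldFloor`; `a ∉ Y`),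

`w_Y` = `w` zeroed on the pairs meeting `Y` (the support graph with `Y` deleted), `U = {o↔S} ∪ {o↔v}`, `Ĉ_a` the vertex span of the open edge
cluster of `a` — every term of the world average is nonnegative (Harris), and on the world «all pairs at `Y` closed» (probability `∏(1 − w_e)`)
the residual weights ARE `w_Y`; plus the influence-product form of row M2-R17 (`CSH.isolated_influenceFloor_le_worldFloor`).  Plugged into row
M2-R6 this gives the (S5) floor at every `|T|` as an explicit, SIZE-FREE polynomial in fixed-graph pivotality probabilities
(`CSH.s5dMargin_ge_sum_rankGain_add_isolatedFloor`; `D = []`).  BENCH row M2-R21 (prim-rate lane).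
[cite: VandenbergHaggstromKahn2005, §2.1 (pp. 9–13)] [cite: Harris1960, Lemma 4.1 (p. 16)] [cite: KozmaNitzan2024, Conj. 4 (p. 32)]
-/

noncomputable section

namespace Summit.CriticalPhenomena.PercolationContinuityZ3.Theorems

open MeasureTheory Set Literature.Probability.LatticeModels Literature.Probability.Percolation
open Literature.Probability.Percolation.BHK2006 (openEdgeCluster_mono)
open scoped Classical
open KNPreFKG

namespace CSH

section General

variable {V : Type*} [Fintype V]

/-- The Harris term of a product measure for a monotone cluster functional against an up-set is nonnegative. [cite: Harris1960, Lemma 4.1 (p. 16)] -/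
theorem harrisTerm_clusterFun_nonneg (p : Sym2 V → unitInterval) (a : V) (U : Set (BondConfig V))
    (hU : ∀ ω ω' : BondConfig V, ω ⊆ ω' → ω ∈ U → ω' ∈ U) (F : Set V → ℝ) (hF : ∀ A B : Set V, A ⊆ B → F A ≤ F B)
    (hF0 : ∀ A : Set V, 0 ≤ F A) :
    0 ≤ (∫ η in U, F {c | c = a ∨ ∃ e ∈ openEdgeCluster η a, c ∈ e} ∂(prodBernoulli p)) -
      (prodBernoulli p).real U * ∫ η, F {c | c = a ∨ ∃ e ∈ openEdgeCluster η a, c ∈ e} ∂(prodBernoulli p) := by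
  have hmeas : ∀ S : Set (BondConfig V), MeasurableSet S := fun _ => MeasurableSet.of_discrete
  set g : BondConfig V → ℝ := fun η => F {c | c = a ∨ ∃ e ∈ openEdgeCluster η a, c ∈ e} with hg
  have hgm : Monotone g := fun _ _ h => (monotone_clusterFun a F hF) (openEdgeCluster_mono h a)
  have h := QuantHarris.influence_mul_influence_le_cov_prodBernoulli p (s(a, a)) g (U.indicator fun _ => (1 : ℝ))
    (fun _ => hF0 _) (fun ω => indicator_nonneg (fun _ _ => zero_le_one) ω) hgm (QuantHarris.indicator_upset_monotone hU)
  have hprod : (fun η => g η * U.indicator (fun _ => (1 : ℝ)) η) = U.indicator g := by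
    funext η
    by_cases hη : η ∈ U
    · rw [indicator_of_mem hη, indicator_of_mem hη, mul_one]
    · rw [indicator_of_notMem hη, indicator_of_notMem hη, mul_zero]
  rw [hprod, integral_indicator (hmeas U), integral_indicator (hmeas U)] at h
  simp only [integral_const, smul_eq_mul, mul_one, measureReal_restrict_apply_univ] at h
  simp only [QuantHarris.indicator_insert_sub_indicator_diff hU] at h
  have h0 : 0 ≤ (p s(a, a) : ℝ) * (1 - p s(a, a)) *
      ((∫ η, (g (insert s(a, a) η) - g (η \ {s(a, a)})) ∂(prodBernoulli p)) *
        ∫ η, ({ω : Set (Sym2 V) | insert s(a, a) ω ∈ U ∧ ω \ {s(a, a)} ∉ U}).indicator (fun _ => (1 : ℝ)) η ∂(prodBernoulli p)) := by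
    refine mul_nonneg (mul_nonneg (p _).2.1 (sub_nonneg.2 (p _).2.2)) (mul_nonneg ?_ ?_)
    · exact integral_nonneg fun η => sub_nonneg.2 (hgm (Set.sdiff_subset.trans (Set.subset_insert _ η)))
    · exact integral_nonneg fun η => indicator_nonneg (fun _ _ => zero_le_one) η
  rw [mul_comm ((prodBernoulli p).real U)]
  linarith

/-- **The world floor dominates the «Y isolated» fixed-graph Harris term.**  `a ∉ Y`; `F` monotone nonnegative on vertex sets; `w_Y` = `w`
zeroed on the pairs meeting `Y`; `U = {o↔S} ∪ {o↔v}`: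
`(∏_{e ∩ Y ≠ ∅} (1 − w_e)) · (∫_U F(Ĉ_a) dμ_{w_Y} − μ_{w_Y}(U)·∫ F(Ĉ_a) dμ_{w_Y}) ≤ worldFloor w a Y S o v F`.  BENCH row M2-R21.
[cite: VandenbergHaggstromKahn2005, §2.1 (pp. 9–13)] [cite: Harris1960, Lemma 4.1 (p. 16)] -/
theorem isolated_harris_le_worldFloor (w : Sym2 V → unitInterval) (a : V) (Y : Set V) (haY : a ∉ Y) (S : Finset V) (o v : V)
    (F : Set V → ℝ) (hF : ∀ A B : Set V, A ⊆ B → F A ≤ F B) (hF0 : ∀ A : Set V, 0 ≤ F A) :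
    (∏ e ∈ Finset.univ.filter (fun e : Sym2 V => ∃ y ∈ Y, y ∈ e), (1 - (w e : ℝ))) *
        ((∫ η in ((⋃ t ∈ S, openConn o t) ∪ openConn o v), F {c | c = a ∨ ∃ e ∈ openEdgeCluster η a, c ∈ e}
            ∂(prodBernoulli fun e => if (∃ y ∈ Y, y ∈ e) then (0 : unitInterval) else w e)) -
          (prodBernoulli fun e => if (∃ y ∈ Y, y ∈ e) then (0 : unitInterval) else w e).real ((⋃ t ∈ S, openConn o t) ∪ openConn o v) *
            (∫ η, F {c | c = a ∨ ∃ e ∈ openEdgeCluster η a, c ∈ e}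
              ∂(prodBernoulli fun e => if (∃ y ∈ Y, y ∈ e) then (0 : unitInterval) else w e))) ≤
      worldFloor w a Y S o v F := by
  set μ := prodBernoulli w with hμ
  set D₀ : Set (BondConfig V) := {ω : BondConfig V | ∀ y ∈ Y, ¬ (openGraph ω).Reachable a y} with hD₀
  set U : Set (BondConfig V) := (⋃ t ∈ S, openConn o t) ∪ openConn o v with hU
  have hmeas : ∀ T : Set (BondConfig V), MeasurableSet T := fun _ => MeasurableSet.of_discrete
  set q : BondConfig V → (Sym2 V → unitInterval) := fun ω e =>
    if (∃ z ∈ e, ∃ y ∈ Y, (openGraph ω).Reachable y z) then (0 : unitInterval) else w e with hq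
  set qY : Sym2 V → unitInterval := fun e => if (∃ y ∈ Y, y ∈ e) then (0 : unitInterval) else w e with hqY
  set H : BondConfig V → ℝ := fun ω =>
    (∫ η in U, F {c | c = a ∨ ∃ e ∈ openEdgeCluster η a, c ∈ e} ∂(prodBernoulli (q ω))) -
      (prodBernoulli (q ω)).real U * ∫ η, F {c | c = a ∨ ∃ e ∈ openEdgeCluster η a, c ∈ e} ∂(prodBernoulli (q ω)) with hH
  set HY : ℝ := (∫ η in U, F {c | c = a ∨ ∃ e ∈ openEdgeCluster η a, c ∈ e} ∂(prodBernoulli qY)) -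
      (prodBernoulli qY).real U * ∫ η, F {c | c = a ∨ ∃ e ∈ openEdgeCluster η a, c ∈ e} ∂(prodBernoulli qY) with hHY
  have hwf : worldFloor w a Y S o v F = ∫ ω in D₀, H ω ∂μ := rfl
  have hUup : ∀ ω ω' : BondConfig V, ω ⊆ ω' → ω ∈ U → ω' ∈ U := by
    rintro ω ω' hle (h | h)
    · obtain ⟨t, ht, h⟩ := Set.mem_iUnion₂.1 h
      exact Or.inl (Set.mem_iUnion₂.2 ⟨t, ht, SimpleGraph.Reachable.mono (BHK2006.openGraph_le hle) h⟩)
    · exact Or.inr (SimpleGraph.Reachable.mono (BHK2006.openGraph_le hle) h)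
  have hH0 : ∀ ω, 0 ≤ H ω := fun ω => harrisTerm_clusterFun_nonneg (q ω) a U hUup F hF hF0
  -- the «Y isolated» event
  set PY : Finset (Sym2 V) := Finset.univ.filter (fun e : Sym2 V => ∃ y ∈ Y, y ∈ e) with hPY
  set Z : Set (BondConfig V) := {ω : BondConfig V | ∀ e ∈ PY, e ∉ ω} with hZ
  have hZμ : μ.real Z = ∏ e ∈ PY, (1 - (w e : ℝ)) := prodBernoulli_real_forall_notMem w PY
  have hiso : ∀ ω ∈ Z, ∀ y ∈ Y, ∀ z, (openGraph ω).Reachable y z → z = y := by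
    intro ω hω y hy z h
    have hyiso : ∀ e ∈ ω, y ∉ e := fun e he hye => hω e (by rw [hPY, Finset.mem_filter]; exact ⟨Finset.mem_univ e, y, hy, hye⟩) he
    exact QuantBHK.eq_of_reachable_of_forall_notMem hyiso h
  have hZD : Z ⊆ D₀ := fun ω hω y hy h => haY ((hiso ω hω y hy a h.symm) ▸ hy)
  have hqZ : ∀ ω ∈ Z, q ω = qY := by
    intro ω hω
    funext e
    have hiff : (∃ z ∈ e, ∃ y ∈ Y, (openGraph ω).Reachable y z) ↔ (∃ y ∈ Y, y ∈ e) := by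
      constructor
      · rintro ⟨z, hz, y, hy, hyz⟩
        exact ⟨y, hy, (hiso ω hω y hy z hyz) ▸ hz⟩
      · rintro ⟨y, hy, hye⟩
        exact ⟨y, hye, y, hy, SimpleGraph.Reachable.refl y⟩
    simp only [hq, hqY]
    by_cases hc : ∃ y ∈ Y, y ∈ e
    · rw [if_pos (hiff.2 hc), if_pos hc]
    · rw [if_neg (fun h => hc (hiff.1 h)), if_neg hc]
  have hHZ : ∀ ω ∈ Z, H ω = HY := by
    intro ω hω
    simp only [hH, hHY, hqZ ω hω]
  have h1 : ∫ ω in Z, H ω ∂μ ≤ ∫ ω in D₀, H ω ∂μ :=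
    setIntegral_mono_set (Integrable.of_finite).integrableOn (Filter.Eventually.of_forall fun ω => hH0 ω)
      (Filter.Eventually.of_forall hZD)
  have h2 : ∫ ω in Z, H ω ∂μ = ∫ ω in Z, HY ∂μ := setIntegral_congr_fun (hmeas Z) fun ω hω => hHZ ω hω
  rw [h2, setIntegral_const, smul_eq_mul] at h1
  rw [hwf, ← hZμ, measureReal_def]
  exact h1

/-- **The world floor dominates the «Y isolated» influence-product term** (size-free, explicit): for every pair `e`, with `w_Y`, `U`, `Ĉ_a`
as in `isolated_harris_le_worldFloor`,
`(∏_{e' ∩ Y ≠ ∅} (1 − w_{e'})) · w_Y(e)(1 − w_Y(e)) · (∫ (F(Ĉ_a(η ∪ e)) − F(Ĉ_a(η ∖ e))) dμ_{w_Y}) · μ_{w_Y}{e pivotal for U} ≤ worldFloor w a Y S o v F`.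
BENCH row M2-R21. [cite: Harris1960, Lemma 4.1 (p. 16)] [cite: Talagrand1996, Thm. 1.1 (p. 244)] -/
theorem isolated_influenceFloor_le_worldFloor (w : Sym2 V → unitInterval) (a : V) (Y : Set V) (haY : a ∉ Y) (S : Finset V) (o v : V)
    (F : Set V → ℝ) (hF : ∀ A B : Set V, A ⊆ B → F A ≤ F B) (hF0 : ∀ A : Set V, 0 ≤ F A) (e : Sym2 V) :
    (∏ e' ∈ Finset.univ.filter (fun e' : Sym2 V => ∃ y ∈ Y, y ∈ e'), (1 - (w e' : ℝ))) *
        ((((fun e' => if (∃ y ∈ Y, y ∈ e') then (0 : unitInterval) else w e') e : unitInterval) : ℝ) *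
            (1 - (((fun e' => if (∃ y ∈ Y, y ∈ e') then (0 : unitInterval) else w e') e : unitInterval) : ℝ)) *
          ((∫ η, (F {c | c = a ∨ ∃ e' ∈ openEdgeCluster (insert e η) a, c ∈ e'} -
                F {c | c = a ∨ ∃ e' ∈ openEdgeCluster (η \ {e}) a, c ∈ e'})
              ∂(prodBernoulli fun e' => if (∃ y ∈ Y, y ∈ e') then (0 : unitInterval) else w e')) *
            (prodBernoulli fun e' => if (∃ y ∈ Y, y ∈ e') then (0 : unitInterval) else w e').real
              {η : BondConfig V | insert e η ∈ (((⋃ t ∈ S, openConn o t) ∪ openConn o v : Set (BondConfig V))) ∧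
                η \ {e} ∉ (((⋃ t ∈ S, openConn o t) ∪ openConn o v : Set (BondConfig V)))})) ≤
      worldFloor w a Y S o v F := by
  set U : Set (BondConfig V) := (⋃ t ∈ S, openConn o t) ∪ openConn o v with hU
  set qY : Sym2 V → unitInterval := fun e' => if (∃ y ∈ Y, y ∈ e') then (0 : unitInterval) else w e' with hqY
  have hmeas : ∀ T : Set (BondConfig V), MeasurableSet T := fun _ => MeasurableSet.of_discrete
  have hbase := isolated_harris_le_worldFloor w a Y haY S o v F hF hF0
  have hUup : ∀ ω ω' : BondConfig V, ω ⊆ ω' → ω ∈ U → ω' ∈ U := by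
    rintro ω ω' hle (h | h)
    · obtain ⟨t, ht, h⟩ := Set.mem_iUnion₂.1 h
      exact Or.inl (Set.mem_iUnion₂.2 ⟨t, ht, SimpleGraph.Reachable.mono (BHK2006.openGraph_le hle) h⟩)
    · exact Or.inr (SimpleGraph.Reachable.mono (BHK2006.openGraph_le hle) h)
  set g : BondConfig V → ℝ := fun η => F {c | c = a ∨ ∃ e' ∈ openEdgeCluster η a, c ∈ e'} with hg
  have hgm : Monotone g := fun _ _ h => (monotone_clusterFun a F hF) (openEdgeCluster_mono h a)
  have h := QuantHarris.influence_mul_influence_le_cov_prodBernoulli qY e g (U.indicator fun _ => (1 : ℝ))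
    (fun _ => hF0 _) (fun ω => indicator_nonneg (fun _ _ => zero_le_one) ω) hgm (QuantHarris.indicator_upset_monotone hUup)
  simp only [QuantHarris.indicator_insert_sub_indicator_diff hUup] at h
  have hprod : (fun η => g η * U.indicator (fun _ => (1 : ℝ)) η) = U.indicator g := by
    funext η
    by_cases hη : η ∈ U
    · rw [indicator_of_mem hη, indicator_of_mem hη, mul_one]
    · rw [indicator_of_notMem hη, indicator_of_notMem hη, mul_zero]
  rw [hprod, integral_indicator (hmeas U), integral_indicator (hmeas _), integral_indicator (hmeas _)] at h
  simp only [integral_const, smul_eq_mul, mul_one, measureReal_restrict_apply_univ] at h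
  rw [mul_comm (∫ η, g η ∂(prodBernoulli qY)) ((prodBernoulli qY).real U)] at h
  have hbase' : (∏ e' ∈ Finset.univ.filter (fun e' : Sym2 V => ∃ y ∈ Y, y ∈ e'), (1 - (w e' : ℝ))) *
      ((∫ η in U, g η ∂(prodBernoulli qY)) - (prodBernoulli qY).real U * ∫ η, g η ∂(prodBernoulli qY)) ≤ worldFloor w a Y S o v F := hbase
  have hP0 : 0 ≤ ∏ e' ∈ Finset.univ.filter (fun e' : Sym2 V => ∃ y ∈ Y, y ∈ e'), (1 - (w e' : ℝ)) :=
    Finset.prod_nonneg fun e' _ => sub_nonneg.2 (w e').2.2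
  exact le_trans (mul_le_mul_of_nonneg_left h hP0) hbase'

end General

/-- **The (S5) floor at every `|T|`, graph-explicit and size-free** (`D = []`, non-degenerate weights, `F` monotone nonnegative, compatible
injective rank, `o ≠ v` off `T`): `Σ_{a∈T} ( γ_a·q_a + ∏_{e ∩ T_{<a} ≠ ∅}(1 − w_e) · Cov_{w_{T<a}}(F(Ĉ_a), 1{o ↔ {a} ∪ T_{>a} ∨ o ↔ v}) ) ≤ s5dMargin w T r [] o v F`
— row M2-R6's world floors replaced by the fixed-graph Harris covariances of the support graphs with the earlier relays deleted.  BENCH row M2-R21.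
[cite: KozmaNitzan2024, Conj. 4 (p. 32)] [cite: VandenbergHaggstromKahn2005, §2.1 (pp. 9–13)] -/
theorem s5dMargin_ge_sum_rankGain_add_isolatedFloor {n : ℕ} (w : Sym2 (Fin n) → unitInterval) (hw : ∀ e, 0 < w e ∧ w e < 1) (o v : Fin n)
    (hov : o ≠ v) (T : Finset (Fin n)) (r : Fin n → ℕ) (F : Set (Fin n) → ℝ)
    (hF : ∀ S S' : Set (Fin n), S ⊆ S' → F S ≤ F S') (hF0 : ∀ S : Set (Fin n), 0 ≤ F S) (hr : Set.InjOn r ↑T)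
    (hcompat : ∀ a ∈ T, ∀ a' ∈ T, r a < r a' →
      ∫ ω, F (openCluster ω a) ∂(prodBernoulli w) ≤ ∫ ω, F (openCluster ω a') ∂(prodBernoulli w))
    (hoT : o ∉ T) (hvT : v ∉ T) :
    ∑ a ∈ T, (rankGain w T r F a * avoidConst w a ((↑(T.erase a) : Set (Fin n)) ∪ ({d | d ∈ ([] : List (Fin n))} ∪ {v})) o +
        (∏ e ∈ Finset.univ.filter (fun e : Sym2 (Fin n) => ∃ y ∈ (↑(T.filter (fun b => r b < r a)) : Set (Fin n)), y ∈ e), (1 - (w e : ℝ))) *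
          ((∫ η in ((⋃ t ∈ (insert a (T.filter (fun b => r a < r b) ∪ ([] : List (Fin n)).toFinset)), openConn o t) ∪ openConn o v),
              F {c | c = a ∨ ∃ e ∈ openEdgeCluster η a, c ∈ e}
              ∂(prodBernoulli fun e => if (∃ y ∈ (↑(T.filter (fun b => r b < r a)) : Set (Fin n)), y ∈ e) then (0 : unitInterval) else w e)) -
            (prodBernoulli fun e => if (∃ y ∈ (↑(T.filter (fun b => r b < r a)) : Set (Fin n)), y ∈ e) then (0 : unitInterval) else w e).real
                ((⋃ t ∈ (insert a (T.filter (fun b => r a < r b) ∪ ([] : List (Fin n)).toFinset)), openConn o t) ∪ openConn o v) *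
              (∫ η, F {c | c = a ∨ ∃ e ∈ openEdgeCluster η a, c ∈ e}
                ∂(prodBernoulli fun e => if (∃ y ∈ (↑(T.filter (fun b => r b < r a)) : Set (Fin n)), y ∈ e) then (0 : unitInterval) else w e))))
      ≤ s5dMargin w T r [] o v F := by
  have hR6 := s5dMargin_ge_sum_rankGain_add_worldFloor w hw o v hov T r [] F hF hF0 hr hcompat hoT hvT List.nodup_nil
    (fun d hd => by simp at hd)
  refine le_trans (Finset.sum_le_sum fun a ha => ?_) hR6
  have haY : a ∉ (↑(T.filter (fun b => r b < r a)) : Set (Fin n)) := by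
    rw [Finset.coe_filter]; exact fun h => lt_irrefl _ h.2
  have h := isolated_harris_le_worldFloor w a (↑(T.filter (fun b => r b < r a)) : Set (Fin n)) haY
    (insert a (T.filter (fun b => r a < r b) ∪ ([] : List (Fin n)).toFinset)) o v F hF hF0
  refine add_le_add le_rfl (Eq.trans_le ?_ h)
  congr! 20

end CSH

end Summit.CriticalPhenomena.PercolationContinuityZ3.Theorems
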